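import Literature.NumberTheory.PAdicHodge.SemiInvariantLevelAbsGalois
import Literature.NumberTheory.PAdicHodge.DeRhamRankOneSemiInvariantVector
import Literature.NumberTheory.GaloisRepresentations.LocalKroneckerWeberContinuousCharacters
import Literature.NumberTheory.GaloisRepresentations.CyclotomicCharacterArtinNormProofs
import HarnessLib

/-!
# De Rham characters of `Γ_F` are locally algebraic (`F/ℚ_ℓ` of degree one)

Literature layer (NumberTheory ▸ PAdicHodge / GaloisRepresentations ▸ Tate's theorem on Hodge–Tate
characters, rank one, degree-one base; theorems only).

Let `F` be an `ℓ`-adic field with `e = f = 1` and `ℚ_ℓ → F` onto (`hπ`, `hq`, `hdeg`), and let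
`r : Γ_F → GL₁(ℚ̄_ℓ)` be a continuous character which is **de Rham** for the Fontaine datum
`fontainePst F ℓ`.  Then `r` is **locally algebraic**: there are `N ≥ 1` and `m ∈ ℤ` with

  `r(σ) = χ_ℓ(σ)^m`  for all `σ ∈ I_F` with `χ_ℓ(σ) ≡ 1 (mod ℓ^N)`

(`apply_eq_cyclotomicCharacter_zpow_of_isDeRhamFramed`); on the Weil group this reads
`r(w) = e(Art_F w)^m` for `w ∈ I_F` with `Art_F(w) ∈ U_F^{(N)}`, for every continuous embedding
`e : F → ℚ̄_ℓ` (`apply_toAbsGalois_eq_zpow_of_isDeRhamFramed`), which is the local input `hloc` of the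
tree's reduction `FramedGaloisRep.exists_heckeCharacter_of_isDeRhamFramed_of_local` at such `F`
(`exists_isOpen_eq_prod_of_isDeRhamFramed`).

## Proof (Tate 1967 §3.3; Serre, *Abelian ℓ-adic representations*, Ch. III §A)

1. `DeRhamRankOne.exists_model_semiInvariant_of_isDeRhamFramed`: `r` has a model `r_E` over a finite
   `E/ℚ_ℓ`, and for every `ℚ_ℓ`-basis `b` of `E` a non-zero vector `x ∈ ℂ_F^κ` with
   `σ • x = χ(σ)^{-m} L_b(r_E(σ⁻¹)) x` (`B_dR`-admissibility ⇒ `θ`-reduction of a `B_dR^+`-period vector).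
2. Local Kronecker–Weber (`LocalKroneckerWeber.exists_unramified_mul_inertial`): the `Eˣ`-valued character
   `r₀ = r_E` factors as `μ ν₀` with `μ` unramified and `ν₀` trivial on `ker χ_ℓ`.
3. Choose `b` adapted to an unramified integral frame of `μ⁻¹`
   (`DegreeOneLevel.exists_basis_integralFrame_character`) and twist `x` by a unit period matrix of that
   frame (`DegreeOneLevel.exists_semiInvariant_unramified_twist`): a non-zero `z` is semi-invariant for the
   character `ν = χ_E^{-m} ν₀⁻¹`, which is trivial on `ker χ_ℓ`.
4. Tate's theorem (`DegreeOneLevel.exists_level_of_semiInvariant`, degree one): `ν` has finite level `N`.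
5. On `σ ∈ I_F` of level `N`: `ν(σ) = 1` and `μ(σ) = 1`, so `r_E(σ) = ν₀(σ) = χ_E(σ)^{-m}`.
6. Weil-group form: `ι(χ_ℓ(w)) = Art_F(w)` on inertia
   (`coe_padicIntRingHom_cyclotomicCharacter_toAbsGalois`), `Art_F(w) ∈ U^{(N)} ⇒ χ_ℓ(w) ≡ 1 (mod ℓ^N)`
   (`pow_dvd_of_valuation_padicIntRingHom_le`), and `e ∘ ι = (ℚ_ℓ → ℚ̄_ℓ)` for continuous `e`
   (`comp_padicRingHom_eq_algebraMap_of_continuous`, density of `ℚ`).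

References: J. Tate, *p-divisible groups* (1967), §3.3 Thm. 2, Cor. 2 [Tate1967]; J.-P. Serre, *Abelian
ℓ-adic representations and elliptic curves* (1968), Ch. III §1.1–1.2 and Appendix A [SerreAbelianLadic1968];
J.-M. Fontaine, Astérisque 223, Exp. III [FontaineAsterisque223III].
-/

noncomputable section

open Field ValuativeRel Matrix Topology Filter
open scoped MatrixGroups

namespace Literature.NumberTheory.PAdicHodge

open Literature.NumberTheory.GaloisRepresentations
open Literature.NumberTheory.GaloisRepresentations.IsNonarchimedeanLocalField

namespace DeRhamRankOne

variable {F : Type} [Field F] [ValuativeRel F] [TopologicalSpace F] [IsNonarchimedeanLocalField F]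
  [CharZero F] {ℓ : ℕ} [Fact ℓ.Prime] (hℓ : valuation F ℓ < 1)

/-! ### Arithmetic of `ι : ℤ_ℓ → 𝒪_F` -/

/-- **`ι : ℤ_ℓ → 𝒪_F` reflects divisibility by powers of `ℓ`**: if `v_F(ι x) ≤ v_F(ℓ)^N` then
`ℓ^N ∣ x` in `ℤ_ℓ` (write `x = u ℓ^k` with `u ∈ ℤ_ℓˣ`; then `v_F(ι x) = v_F(ℓ)^k`, and `v_F(ℓ) < 1`
forces `N ≤ k`). [cite: SerreLocalFields1979, Ch. II §5] -/
theorem pow_dvd_of_valuation_padicIntRingHom_le {x : ℤ_[ℓ]} {N : ℕ}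
    (h : valuation F ((LocalField.padicIntRingHom F ℓ hℓ x : 𝒪[F]) : F) ≤ valuation F (ℓ : F) ^ N) :
    (ℓ : ℤ_[ℓ]) ^ N ∣ x := by
  by_cases hx : x = 0
  · rw [hx]; exact dvd_zero _
  have hspec := PadicInt.unitCoeff_spec hx
  set k := x.valuation with hk
  set u := PadicInt.unitCoeff hx with hu
  -- `v_F(ι u) = 1`
  have hunit : valuation F ((LocalField.padicIntRingHom F ℓ hℓ (u : ℤ_[ℓ]) : 𝒪[F]) : F) = 1 :=
    Valuation.Integers.one_of_isUnit (Valuation.integer.integers (valuation F))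
      ((u.isUnit).map (LocalField.padicIntRingHom F ℓ hℓ))
  -- `v_F(ι x) = v_F(ℓ)^k`
  have hval : valuation F ((LocalField.padicIntRingHom F ℓ hℓ x : 𝒪[F]) : F) =
      valuation F (ℓ : F) ^ k := by
    conv_lhs => rw [hspec]
    rw [map_mul, map_pow, map_natCast, Subring.coe_mul, Subring.coe_pow, SubringClass.coe_natCast,
      map_mul, map_pow, hunit, one_mul]
  rw [hval] at h
  have h0 : 0 < valuation F (ℓ : F) := zero_lt_iff.mpr (LocalField.valuation_natCast_ne_zero F ℓ)
  have hNk : N ≤ k := (pow_le_pow_iff_right_of_lt_one₀ h0 hℓ).mp h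
  calc (ℓ : ℤ_[ℓ]) ^ N ∣ (ℓ : ℤ_[ℓ]) ^ k := pow_dvd_pow _ hNk
    _ ∣ x := ⟨u, by rw [mul_comm]; exact hspec⟩

/-- **Continuous embeddings `F → ℚ̄_ℓ` restrict to the inclusion on `ℚ_ℓ`**: `e ∘ ι = (ℚ_ℓ → ℚ̄_ℓ)` for
continuous `e`, both sides being continuous ring maps agreeing on the dense subfield `ℚ`.
[cite: SerreLocalFields1979, Ch. II §3] -/
theorem comp_padicRingHom_eq_algebraMap_of_continuous (e : F →+* PadicAlgCl ℓ) (he : Continuous e) :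
    e.comp (LocalField.padicRingHom F ℓ hℓ) = algebraMap ℚ_[ℓ] (PadicAlgCl ℓ) := by
  have hc1 : Continuous (e.comp (LocalField.padicRingHom F ℓ hℓ)) :=
    he.comp (LocalField.continuous_padicRingHom F ℓ hℓ)
  have hc2 : Continuous (algebraMap ℚ_[ℓ] (PadicAlgCl ℓ)) := continuous_algebraMap ℚ_[ℓ] (PadicAlgCl ℓ)
  have h := DenseRange.equalizer (Padic.denseRange_ratCast ℓ) hc1 hc2
    (funext fun q : ℚ => by simp only [Function.comp_apply, map_ratCast])
  exact RingHom.ext fun a => congrFun h a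

/-! ### Tate's theorem: de Rham characters are locally algebraic -/

/-- **De Rham characters of `Γ_F` are locally powers of the cyclotomic character** (`F/ℚ_ℓ` of degree
one, `e = f = 1`).  If `r : Γ_F → GL₁(ℚ̄_ℓ)` is de Rham for `fontainePst F ℓ`, then there are `N ≥ 1` and
`m ∈ ℤ` with `r(σ) = χ_ℓ(σ)^m` for every `σ` in the inertia group with `χ_ℓ(σ) ≡ 1 (mod ℓ^N)`.
(Tate: Hodge–Tate characters are locally algebraic; here via `B_dR`-periods, the unramified twist and
Tate's theorem on semi-invariants of `ℂ_F`.)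
[cite: Tate1967, §3.3 Theorem 2, Corollary 2] [cite: SerreAbelianLadic1968, Ch. III, Appendix A]
[cite: FontaineAsterisque223III, Exp. III §1.5] -/
theorem apply_eq_cyclotomicCharacter_zpow_of_isDeRhamFramed
    (hπ : (valuation F).IsUniformizer (((ℓ : ℕ) : 𝒪[F]) : F)) (hq : residueFieldCard F = ℓ)
    (hdeg : Function.Surjective (LocalField.padicRingHom F ℓ hℓ))
    (r : FramedRep (absoluteGaloisGroup F) (PadicAlgCl ℓ) 1) (hr : (fontainePst F ℓ hℓ).IsDeRhamFramed r) :
    ∃ (N : ℕ) (m : ℤ), 0 < N ∧ ∀ σ ∈ absInertia F,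
      PadicInt.toZModPow N ((GaloisRep.cyclotomicCharacter F ℓ σ : ℤ_[ℓ]ˣ) : ℤ_[ℓ]) = 1 →
        ((r σ : GL (Fin 1) (PadicAlgCl ℓ)) : Matrix (Fin 1) (Fin 1) (PadicAlgCl ℓ)) 0 0 =
          algebraMap ℚ_[ℓ] (PadicAlgCl ℓ)
            (((GaloisRep.cyclotomicCharacter F ℓ σ : ℤ_[ℓ]ˣ) : ℤ_[ℓ]) : ℚ_[ℓ]) ^ m := by
  classical
  -- (1) a model over a finite `E/ℚ_ℓ` and its semi-invariant vectors
  obtain ⟨E, hfd, rE, hmodel, hvec⟩ := exists_model_semiInvariant_of_isDeRhamFramed hℓ r hr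
  haveI := hfd
  -- the character `r₀ = r_E : Γ_F → Eˣ`
  let r₀ : absoluteGaloisGroup F →* (E)ˣ := (Matrix.GeneralLinearGroup.det).comp rE.toMonoidHom
  have hr₀ : ∀ σ, (r₀ σ : E) = ((rE σ : GL (Fin 1) E) : Matrix (Fin 1) (Fin 1) E) 0 0 := fun σ => by
    show ((rE σ : GL (Fin 1) E) : Matrix (Fin 1) (Fin 1) E).det = _
    exact Matrix.det_fin_one _
  have h1 : Continuous fun σ => ((rE σ : GL (Fin 1) E) : Matrix (Fin 1) (Fin 1) E) :=
    Units.continuous_val.comp rE.continuous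
  have hr₀c : Continuous r₀ := by
    refine Units.continuous_iff.mpr ⟨?_, ?_⟩
    · show Continuous fun σ => (r₀ σ : E)
      simp_rw [hr₀]
      exact h1.matrix_elem 0 0
    · show Continuous fun σ => (((r₀ σ)⁻¹ : (E)ˣ) : E)
      have h2 : (fun σ => (((r₀ σ)⁻¹ : (E)ˣ) : E)) =
          fun σ => ((rE σ⁻¹ : GL (Fin 1) E) : Matrix (Fin 1) (Fin 1) E) 0 0 := by
        funext σ; rw [← map_inv, hr₀]
      rw [h2]
      exact (h1.comp continuous_inv).matrix_elem 0 0
  -- (2) local Kronecker–Weber: `r₀ = μ ν₀`, `μ` unramified, `ν₀` trivial on `ker χ`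
  obtain ⟨μ, ν₀, hdec, hμc, hν₀c, hμI, hν₀χ, -⟩ :=
    LocalKroneckerWeber.exists_unramified_mul_inertial hπ hq hℓ r₀ hr₀c
  -- (3) a basis adapted to an unramified integral frame of `μ⁻¹`
  have hμ'c : Continuous (μ⁻¹ : absoluteGaloisGroup F →* (E)ˣ) := by
    show Continuous fun σ => (μ σ)⁻¹
    exact hμc.inv
  have hμ'I : ∀ σ ∈ absInertia F, (μ⁻¹ : absoluteGaloisGroup F →* (E)ˣ) σ = 1 := fun σ hσ => by
    rw [MonoidHom.inv_apply, hμI σ hσ, inv_one]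
  obtain ⟨b, rint, hrintI, hLμ⟩ :=
    DegreeOneLevel.exists_basis_integralFrame_character (F := F) (p := ℓ) μ⁻¹ hμ'c hμ'I
  -- (4) the semi-invariant vector of the model in this basis
  obtain ⟨m, x, hx0, hx⟩ := hvec b
  -- the cyclotomic character with values in `Eˣ`
  let χE : absoluteGaloisGroup F →* (E)ˣ :=
    (Units.map ((algebraMap ℚ_[ℓ] E : ℚ_[ℓ] →+* E) : ℚ_[ℓ] →* E)).comp
      ((Units.map ((PadicInt.Coe.ringHom : ℤ_[ℓ] →+* ℚ_[ℓ]) : ℤ_[ℓ] →* ℚ_[ℓ])).comp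
        (GaloisRep.cyclotomicCharacter F ℓ).toMonoidHom)
  have hχE : ∀ σ, (χE σ : E) =
      algebraMap ℚ_[ℓ] E (((GaloisRep.cyclotomicCharacter F ℓ σ : ℤ_[ℓ]ˣ) : ℤ_[ℓ]) : ℚ_[ℓ]) :=
    fun _ => rfl
  have hχEc : Continuous χE := by
    refine (Continuous.units_map _ (continuous_algebraMap ℚ_[ℓ] E)).comp
      ((Continuous.units_map _ ?_).comp (GaloisRep.cyclotomicCharacter F ℓ).continuous)
    exact (continuous_subtype_val : Continuous fun z : ℤ_[ℓ] => (z : ℚ_[ℓ]))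
  -- the twisting scalar `e₁ σ = χ_E(σ)^{-m} r₀(σ⁻¹)`
  let e₁ : absoluteGaloisGroup F → E := fun σ => ((χE σ ^ (-m) * r₀ σ⁻¹ : (E)ˣ) : E)
  have he₁ : ∀ σ, e₁ σ =
      ((((GaloisRep.cyclotomicCharacter F ℓ σ : ℤ_[ℓ]ˣ) : ℤ_[ℓ]) : ℚ_[ℓ]) ^ (-m)) •
        ((rE σ⁻¹ : GL (Fin 1) E) : Matrix (Fin 1) (Fin 1) E) 0 0 := by
    intro σ
    show ((χE σ ^ (-m) * r₀ σ⁻¹ : (E)ˣ) : E) = _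
    rw [Units.val_mul, Units.val_zpow_eq_zpow_val, hχE, hr₀, Algebra.smul_def, map_zpow₀]
  have hx' : ∀ (σ : absoluteGaloisGroup F) (k : Fin (Module.finrank ℚ_[ℓ] E)), σ • x k =
      ∑ j, algebraMap F (CompletedAlgClosure F)
        (LocalField.padicRingHom F ℓ hℓ (Algebra.leftMulMatrix b (e₁ σ) k j)) * x j := by
    intro σ k
    rw [hx σ k, he₁, map_smul]
    simp only [Matrix.smul_apply, smul_eq_mul, map_mul, map_zpow₀, Finset.mul_sum, mul_assoc]
  -- (5) the unramified twist: a semi-invariant vector for `ν = χ_E^{-m} ν₀⁻¹`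
  obtain ⟨z, hz0, hz⟩ :=
    DegreeOneLevel.exists_semiInvariant_unramified_twist hℓ b μ⁻¹ rint hrintI hLμ e₁ hx0 hx'
  let ν : absoluteGaloisGroup F →* (E)ˣ := χE ^ (-m) * ν₀⁻¹
  have hν : ∀ σ, ν σ = χE σ ^ (-m) * (ν₀ σ)⁻¹ := fun σ => by
    show (χE ^ (-m) * ν₀⁻¹) σ = _
    rw [MonoidHom.mul_apply, MonoidHom.inv_apply, MonoidHom.zpow_apply]
  have hνval : ∀ σ, (ν σ : E) = e₁ σ * ((μ⁻¹ : absoluteGaloisGroup F →* (E)ˣ) σ⁻¹ : E) := by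
    intro σ
    have hu : ν σ = χE σ ^ (-m) * r₀ σ⁻¹ * (μ⁻¹ : absoluteGaloisGroup F →* (E)ˣ) σ⁻¹ := by
      rw [hν, MonoidHom.inv_apply, hdec σ⁻¹, map_inv μ, map_inv ν₀, inv_inv, mul_assoc,
        mul_comm (μ σ)⁻¹ (ν₀ σ)⁻¹, inv_mul_cancel_right]
    rw [hu, Units.val_mul]
  have hz' : ∀ (σ : absoluteGaloisGroup F) (k : Fin (Module.finrank ℚ_[ℓ] E)), σ • z k =
      ∑ j, algebraMap F (CompletedAlgClosure F)
        (LocalField.padicRingHom F ℓ hℓ (Algebra.leftMulMatrix b (ν σ : E) k j)) * z j := by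
    intro σ k
    rw [hνval]
    exact hz σ k
  -- `ν` is trivial on `ker χ` and has continuous regular representation
  have hνχ : ∀ σ, GaloisRep.cyclotomicCharacter F ℓ σ = 1 → ν σ = 1 := by
    intro σ hσ
    have hχEσ : χE σ = 1 := by
      ext
      rw [hχE, hσ, Units.val_one, PadicInt.coe_one, map_one, Units.val_one]
    rw [hν, hχEσ, _root_.one_zpow, one_mul, hν₀χ σ hσ, inv_one]
  have hνc : Continuous fun σ => (ν σ : E) := by
    have h : Continuous fun σ => χE σ ^ (-m) * (ν₀ σ)⁻¹ := (hχEc.zpow (-m)).mul hν₀c.inv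
    simp_rw [← hν] at h
    exact Units.continuous_val.comp h
  have hcontν : ∀ k j, Continuous fun σ => Algebra.leftMulMatrix b (ν σ : E) k j :=
    fun k j => DegreeOneLevel.continuous_leftMulMatrix_apply b hνc k j
  -- (6) Tate's theorem: `ν` has finite level
  obtain ⟨N, hN0, hN⟩ := DegreeOneLevel.exists_level_of_semiInvariant hℓ hdeg b ν hνχ hcontν hz0 hz'
  refine ⟨N, -m, hN0, fun σ hσI hσN => ?_⟩
  -- (7) on inertia of level `N`: `r₀ σ = ν₀ σ = χ_E(σ)^{-m}`
  have hνσ : ν σ = 1 := hN σ hσN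
  have hν₀σ : ν₀ σ = χE σ ^ (-m) := by
    rw [hν, mul_inv_eq_one] at hνσ
    exact hνσ.symm
  have hr₀σ : r₀ σ = χE σ ^ (-m) := by rw [hdec, hμI σ hσI, one_mul, hν₀σ]
  rw [hmodel, ← hr₀, hr₀σ, Units.val_zpow_eq_zpow_val, hχE, map_zpow₀,
    ← IsScalarTower.algebraMap_apply]

/-! ### Weil-group form: the local input `hloc` -/

/-- **Weil-group form** (`F/ℚ_ℓ` of degree one): for a de Rham character `r : Γ_F → GL₁(ℚ̄_ℓ)` and a
continuous embedding `e : F → ℚ̄_ℓ` there are `N ≥ 1`, `m ∈ ℤ` with `r(w) = e(Art_F w)^m` for all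
`w ∈ I_F` with `Art_F(w) ∈ U_F^{(N)}` — since `ι(χ_ℓ(w)) = Art_F(w)` on inertia (Lubin–Tate) and
`Art_F(w) ≡ 1 (mod 𝔭^N)` forces `χ_ℓ(w) ≡ 1 (mod ℓ^N)`.
[cite: Tate1967, §3.3 Corollary 2] [cite: SerreAbelianLadic1968, Ch. III §A.5] -/
theorem apply_toAbsGalois_eq_zpow_of_isDeRhamFramed
    (hπ : (valuation F).IsUniformizer (((ℓ : ℕ) : 𝒪[F]) : F)) (hq : residueFieldCard F = ℓ)
    (hdeg : Function.Surjective (LocalField.padicRingHom F ℓ hℓ))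
    (e : F →+* PadicAlgCl ℓ) (he : Continuous e)
    (r : FramedRep (absoluteGaloisGroup F) (PadicAlgCl ℓ) 1) (hr : (fontainePst F ℓ hℓ).IsDeRhamFramed r) :
    ∃ (N : ℕ) (m : ℤ), 0 < N ∧ ∀ w ∈ WeilGroup.inertia F,
      canonicalArtin F w ∈ higherUnitGroup F N →
        ((r (WeilGroup.toAbsGalois F w) : GL (Fin 1) (PadicAlgCl ℓ)) :
            Matrix (Fin 1) (Fin 1) (PadicAlgCl ℓ)) 0 0 =
          e ((canonicalArtin F w : Fˣ) : F) ^ m := by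
  obtain ⟨N, m, hN0, hN⟩ := apply_eq_cyclotomicCharacter_zpow_of_isDeRhamFramed hℓ hπ hq hdeg r hr
  refine ⟨N, m, hN0, fun w hw hU => ?_⟩
  have hwI : WeilGroup.toAbsGalois F w ∈ absInertia F := WeilGroup.mem_inertia_iff.mp hw
  -- `ι(χ(w)) = Art(w)`
  have hart := coe_padicIntRingHom_cyclotomicCharacter_toAbsGalois hπ hq hℓ hw
  set c : ℤ_[ℓ] := ((GaloisRep.cyclotomicCharacter F ℓ (WeilGroup.toAbsGalois F w) : ℤ_[ℓ]ˣ) : ℤ_[ℓ])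
    with hc
  -- `Art(w) ∈ U^{(N)}` gives `χ(w) ≡ 1 (mod ℓ^N)`
  have hlevel : PadicInt.toZModPow N c = 1 := by
    have hv : valuation F ((LocalField.padicIntRingHom F ℓ hℓ (c - 1) : 𝒪[F]) : F) ≤
        valuation F (ℓ : F) ^ N := by
      have hsub : ((LocalField.padicIntRingHom F ℓ hℓ (c - 1) : 𝒪[F]) : F) =
          (canonicalArtin F w : F) - 1 := by
        rw [map_sub, map_one, AddSubgroupClass.coe_sub, OneMemClass.coe_one, hart]
      have hunif : valuation F (ℓ : F) = unifValue F := by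
        rw [← isUniformizer_iff_valuation_eq_unifValue]
        simpa only [SubringClass.coe_natCast] using hπ
      rw [hsub, hunif]
      exact (mem_higherUnitGroup_iff.mp hU).2
    have hdvd := pow_dvd_of_valuation_padicIntRingHom_le hℓ hv
    have hker : c - 1 ∈ RingHom.ker (PadicInt.toZModPow N) := by
      rw [PadicInt.ker_toZModPow, Ideal.mem_span_singleton]
      exact hdvd
    rw [RingHom.mem_ker, map_sub, map_one, sub_eq_zero] at hker
    exact hker
  rw [hN _ hwI hlevel, ← hart, ← LocalField.padicRingHom_coe, ← RingHom.comp_apply,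
    comp_padicRingHom_eq_algebraMap_of_continuous hℓ e he]

/-- **The local input `hloc` at `F`** (`F/ℚ_ℓ` of degree one, given a continuous embedding
`e : F → ℚ̄_ℓ`): a de Rham character `r : Γ_F → GL₁(ℚ̄_ℓ)` agrees on `{w ∈ I_F : Art_F(w) ∈ V}`, for an
open subgroup `V = U_F^{(N)}` of `Fˣ`, with the algebraic character `u ↦ e(u)^m` — the shape of the
hypothesis `hloc` of `FramedGaloisRep.exists_heckeCharacter_of_isDeRhamFramed_of_local`.
[cite: Tate1967, §3.3 Corollary 2] [cite: SerreAbelianLadic1968, Ch. III §A.5] -/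
theorem exists_isOpen_eq_prod_of_isDeRhamFramed
    (hπ : (valuation F).IsUniformizer (((ℓ : ℕ) : 𝒪[F]) : F)) (hq : residueFieldCard F = ℓ)
    (hdeg : Function.Surjective (LocalField.padicRingHom F ℓ hℓ))
    (e : F →+* PadicAlgCl ℓ) (he : Continuous e)
    (r : FramedRep (absoluteGaloisGroup F) (PadicAlgCl ℓ) 1) (hr : (fontainePst F ℓ hℓ).IsDeRhamFramed r) :
    ∃ V : Subgroup Fˣ, IsOpen (V : Set Fˣ) ∧
      ∃ (s : Finset (F →+* PadicAlgCl ℓ)) (n : (F →+* PadicAlgCl ℓ) → ℤ),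
        (∀ e ∈ s, Continuous e) ∧
        ∀ w ∈ WeilGroup.inertia F, canonicalArtin F w ∈ V →
          ((r (WeilGroup.toAbsGalois F w) : GL (Fin 1) (PadicAlgCl ℓ)) :
              Matrix (Fin 1) (Fin 1) (PadicAlgCl ℓ)) 0 0 =
            ∏ e ∈ s, e ((canonicalArtin F w : Fˣ) : F) ^ n e := by
  classical
  obtain ⟨N, m, hN0, hN⟩ := apply_toAbsGalois_eq_zpow_of_isDeRhamFramed hℓ hπ hq hdeg e he r hr
  refine ⟨higherUnitGroup F N, isOpen_higherUnitGroup F hN0, {e}, fun _ => m, ?_, fun w hw hU => ?_⟩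
  · intro e' he'
    rw [Finset.mem_singleton] at he'
    rw [he']
    exact he
  · rw [Finset.prod_singleton]
    exact hN w hw hU

end DeRhamRankOne

end Literature.NumberTheory.PAdicHodge

end
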